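import Mathlib.Analysis.Complex.Basic
import Mathlib.Topology.MetricSpace.HausdorffDistance
import Mathlib.Topology.Instances.NNReal.Lemmas
import Mathlib.Topology.UnitInterval
import Literature.Probability.RandomPlanarGeometry.Curve

/-!
# `stub_compat` — coarse anti-monotonicity of the forward and backward level structures
(crux `PathUpgradeR`, stmt-CriticalPhenomena-18055, route `SAWReversalUpgrade`, line `bidir_windows`)

Landing target:
`Summits/CriticalPhenomena/SAWScalingLimit/Theorems/SAWReversalUpgradePathUpgradeRCompat.lean`
(`--supports stmt-CriticalPhenomena-18055`; registered stub `stub_compat` of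
`Cruxes/PathUpgradeR/Lines/bidir_windows.lean`, statement verbatim).

**Setting (purely metric).** A simple curve `X : Curve ℂ`; its initial segments `Xf [0,t]`
(`t ≤ T+1`) are `ε`-shadowed in Hausdorff distance by a continuous reference curve `r` (with an
injectivity modulus `injF`/`inj0F` and a continuity modulus `contF`), its final segments `Xb [0,t]`
(`t ≤ T'+1`) are `ε'`-shadowed by a second reference curve `r'` (moduli `injB`, `contB`); the top
forward segment is `X [0,utop]`; the reference point `r (T+1)` is deep inside the ball `B(b, rb)`
from which `X` cannot escape beyond radius `rb'` (`Z5`), while `r u` for `u ≤ Ttop + 2w` is far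
from `b` (`Z2`).

**Theorem.** If `y₁ = X v₁` has forward level `u₁` and `y₂ = X v₂` has forward level
`u₂ ≥ u₁ + 2c₀` (`u₂ ≤ Ttop`), and `u₁'`, `u₂'` are backward levels of `y₁`, `y₂`, then
`u₂' + c₁ ≤ u₁'`.

**Proof.** Suppose `u₁' < u₂' + c₁`.
* If moreover `u₂' - c₁ ≤ u₁'`, the five-term triangle inequality
  `dist (r u₁) (r u₂) ≤ 2ε + 2ε' + dist (r' u₁') (r' u₂') + 2ε' + 2ε < μ₀` (`contB`) contradicts
  `inj0F` (`|u₁ - u₂| ≥ 2c₀ ≥ c₀/4`).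
* Otherwise `u₁' + c₁ < u₂'`. The backward past `X [vb,1] = Xb [0,u₁']` contains a point `X vz`
  within `ε'` of `r' u₁'`, hence within `2ε + 3ε'` of `r u₁`, hence (by `Z2`) outside
  `B(b, rb')`. The top segment `X [0,utop]` contains a point `X vs` within `ε` of `r (T+1)`, hence
  in `B(b, rb)`; by the no-escape clause `Z5`, `vz ≤ vs`. Every `X v`, `v ∈ [vz, vs]`, has an
  `ε`-witness `u ∈ [0, T+1]` (`dist (X v) (r u) ≤ ε`); the witness of `vz` is `< u₁ + w ≤ u₂`, and
  `T + 1 ≥ u₂` is a witness of `vs`. The sets of `v ∈ [vz, vs]` admitting a witness `≤ u₂`, resp.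
  `≥ u₂`, are closed (continuity of `v ↦ infDist (X v) (r '' K)`, `K` compact) and cover the
  connected interval `[vz, vs]`, so some `vm` has witnesses `ua ≤ u₂ ≤ ub`; two witnesses of one
  point differ by `< w` (`injF`, `2ε < μ`), so `u₂ ≤ ub < u₂ + w`. Now `X vm ∈ X [vb,1]` is within
  `ε'` of some `r' s₃`, `s₃ ≤ u₁'`, and
  `dist (r' s₃) (r' u₂') ≤ ε' + ε + ν + 2ε + 2ε' < μ''` (`contF` for `dist (r ub) (r u₂) ≤ ν`),
  so `injB` forces `|s₃ - u₂'| < w'' ≤ c₁`, contradicting `s₃ ≤ u₁' < u₂' - c₁`. ∎ [folklore]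
-/

open Set Metric Topology
open scoped NNReal
open Literature.Probability.RandomPlanarGeometry

namespace Summit.CriticalPhenomena.SAWScalingLimit.Theorems

namespace PathUpgradeRCompat

/-! ### Hausdorff-distance witnesses -/

/-- If `hausdorffDist s t ≤ δ` with `s` bounded and `t` compact nonempty, every point of `s` is
within `δ` of a point of `t`. [folklore] -/
theorem exists_dist_le_of_hausdorffDist_le {α : Type*} [PseudoMetricSpace α] {s t : Set α}
    {x : α} {δ : ℝ} (hs : Bornology.IsBounded s) (ht : IsCompact t) (htne : t.Nonempty)
    (hx : x ∈ s) (hH : hausdorffDist s t ≤ δ) : ∃ y ∈ t, dist x y ≤ δ := by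
  obtain ⟨y, hy, hyd⟩ := ht.exists_infDist_eq_dist htne x
  refine ⟨y, hy, ?_⟩
  rw [← hyd]
  exact (infDist_le_hausdorffDist_of_mem hx
    (hausdorffEDist_ne_top_of_nonempty_of_bounded ⟨x, hx⟩ htne hs ht.isBounded)).trans hH

/-- If `hausdorffDist s t ≤ δ` with `s` compact nonempty and `t` bounded, every point of `t` is
within `δ` of a point of `s`. [folklore] -/
theorem exists_dist_le_of_hausdorffDist_le' {α : Type*} [PseudoMetricSpace α] {s t : Set α}
    {y : α} {δ : ℝ} (hs : IsCompact s) (hsne : s.Nonempty) (ht : Bornology.IsBounded t)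
    (hy : y ∈ t) (hH : hausdorffDist s t ≤ δ) : ∃ x ∈ s, dist x y ≤ δ := by
  rw [hausdorffDist_comm] at hH
  obtain ⟨x, hx, hxd⟩ := exists_dist_le_of_hausdorffDist_le ht hs hsne hy hH
  exact ⟨x, hx, by rwa [dist_comm]⟩

/-! ### Levels: comparison of witnesses and the coarse intermediate-value step -/

/-- Two `r`-times (below the horizon `Tm`) whose images are closer than the injectivity modulus
`μ` differ by less than `w`. [folklore] -/
theorem abs_sub_lt_of_dist_lt {r : ℝ≥0 → ℂ} {Tm s t : ℝ≥0} {μ w : ℝ}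
    (injF : ∀ s t : ℝ≥0, s ≤ Tm → t ≤ Tm → w ≤ |(s : ℝ) - t| → μ ≤ dist (r s) (r t))
    (hs : s ≤ Tm) (ht : t ≤ Tm) (hd : dist (r s) (r t) < μ) : |(s : ℝ) - t| < w :=
  not_le.1 fun h => absurd hd (not_lt.2 (injF s t hs ht h))

/-- Coarse intermediate-value step. Every point `Y v`, `v ∈ [vz, vs]`, has an `ε`-witness
`u ≤ Tm` (`dist (Y v) (r u) ≤ ε`), `Y vz` has a witness `≤ u₂` and `Y vs` a witness in `[u₂, Tm]`;
two witnesses of one point differ by `< w` (injectivity modulus, `2ε < μ`). Then some `Y v`,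
`v ∈ [vz, vs]`, has a witness in `[u₂, u₂ + w)`: the sets of parameters admitting a witness `≤ u₂`,
resp. `≥ u₂`, are closed, cover the connected interval `[vz, vs]` and are nonempty, so they meet.
[folklore] -/
theorem exists_level_crossing {Y : unitInterval → ℂ} (hY : Continuous Y) {r : ℝ≥0 → ℂ}
    (hr : Continuous r) {Tm u₂ : ℝ≥0} (hu₂ : u₂ ≤ Tm) {ε μ w : ℝ} (hεμ : 2 * ε < μ)
    (injF : ∀ s t : ℝ≥0, s ≤ Tm → t ≤ Tm → w ≤ |(s : ℝ) - t| → μ ≤ dist (r s) (r t))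
    {vz vs : unitInterval} (hzs : vz ≤ vs)
    (hcover : ∀ v ∈ Set.Icc vz vs, ∃ u : ℝ≥0, u ≤ Tm ∧ dist (Y v) (r u) ≤ ε)
    (hz : ∃ u : ℝ≥0, u ≤ u₂ ∧ dist (Y vz) (r u) ≤ ε)
    (hs : ∃ u : ℝ≥0, u₂ ≤ u ∧ u ≤ Tm ∧ dist (Y vs) (r u) ≤ ε) :
    ∃ v ∈ Set.Icc vz vs, ∃ u : ℝ≥0, u₂ ≤ u ∧ (u : ℝ) < u₂ + w ∧ u ≤ Tm ∧
      dist (Y v) (r u) ≤ ε := by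
  have hKa : IsCompact (r '' Set.Icc 0 u₂) := isCompact_Icc.image hr
  have hKb : IsCompact (r '' Set.Icc u₂ Tm) := isCompact_Icc.image hr
  have hAc : IsClosed {v : unitInterval | infDist (Y v) (r '' Set.Icc 0 u₂) ≤ ε} :=
    isClosed_le ((continuous_infDist_pt _).comp hY) continuous_const
  have hBc : IsClosed {v : unitInterval | infDist (Y v) (r '' Set.Icc u₂ Tm) ≤ ε} :=
    isClosed_le ((continuous_infDist_pt _).comp hY) continuous_const
  have hconn : IsPreconnected (Set.Icc vz vs) := by
    rw [← IsInducing.subtypeVal.isPreconnected_image, Set.image_subtype_val_Icc]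
    exact isPreconnected_Icc
  have hsub : Set.Icc vz vs ⊆ {v : unitInterval | infDist (Y v) (r '' Set.Icc 0 u₂) ≤ ε} ∪
      {v : unitInterval | infDist (Y v) (r '' Set.Icc u₂ Tm) ≤ ε} := by
    intro v hv
    obtain ⟨u, huT, hu⟩ := hcover v hv
    rcases le_total u u₂ with h | h
    · exact Or.inl ((infDist_le_dist_of_mem
        (mem_image_of_mem r (show u ∈ Set.Icc 0 u₂ from ⟨zero_le, h⟩))).trans hu)
    · exact Or.inr ((infDist_le_dist_of_mem
        (mem_image_of_mem r (show u ∈ Set.Icc u₂ Tm from ⟨h, huT⟩))).trans hu)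
  have hzA : (Set.Icc vz vs ∩ {v : unitInterval | infDist (Y v) (r '' Set.Icc 0 u₂) ≤ ε}).Nonempty := by
    obtain ⟨u, hu, hd⟩ := hz
    exact ⟨vz, left_mem_Icc.2 hzs,
      (infDist_le_dist_of_mem (mem_image_of_mem r (show u ∈ Set.Icc 0 u₂ from ⟨zero_le, hu⟩))).trans hd⟩
  have hsB : (Set.Icc vz vs ∩ {v : unitInterval | infDist (Y v) (r '' Set.Icc u₂ Tm) ≤ ε}).Nonempty := by
    obtain ⟨u, hu, huT, hd⟩ := hs
    exact ⟨vs, right_mem_Icc.2 hzs,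
      (infDist_le_dist_of_mem (mem_image_of_mem r (show u ∈ Set.Icc u₂ Tm from ⟨hu, huT⟩))).trans hd⟩
  obtain ⟨v, hv, hvA, hvB⟩ := isPreconnected_closed_iff.1 hconn _ _ hAc hBc hsub hzA hsB
  have hvA' : infDist (Y v) (r '' Set.Icc 0 u₂) ≤ ε := hvA
  have hvB' : infDist (Y v) (r '' Set.Icc u₂ Tm) ≤ ε := hvB
  obtain ⟨_, ⟨ua, hua, rfl⟩, hda⟩ :=
    hKa.exists_infDist_eq_dist ((nonempty_Icc.2 (zero_le (a := u₂))).image r) (Y v)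
  obtain ⟨_, ⟨ub, hub, rfl⟩, hdb⟩ :=
    hKb.exists_infDist_eq_dist ((nonempty_Icc.2 hu₂).image r) (Y v)
  rw [hda] at hvA'
  rw [hdb] at hvB'
  have hclose : |(ua : ℝ) - ub| < w := by
    refine abs_sub_lt_of_dist_lt injF (hua.2.trans hu₂) hub.2 ?_
    linarith [dist_triangle_left (r ua) (r ub) (Y v)]
  have hua₂ : (ua : ℝ) ≤ u₂ := NNReal.coe_le_coe.2 hua.2
  refine ⟨v, hv, ub, hub.1, ?_, hub.2, hvB'⟩
  rw [abs_sub_lt_iff] at hclose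
  linarith [hclose.1, hclose.2]

end PathUpgradeRCompat

open PathUpgradeRCompat in
/-- **Coarse anti-monotonicity of the two level structures** (`Compat` of the line
`bidir_windows`): for a simple curve `X` whose initial segments are `ε`-shadowed by `r` and whose
final segments are `ε'`-shadowed by `r'` (with injectivity/continuity moduli, the far clause `Z2`,
the top clause `Ztop` and the no-escape clause `Z5` at `b`), a forward level gap
`u₁ + 2c₀ ≤ u₂ ≤ Ttop` between `X v₁` and `X v₂` forces the backward levels to satisfy
`u₂' + c₁ ≤ u₁'`. Case `|u₁' - u₂'| ≤ c₁`: five-term triangle inequality against `μ₀`; case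
`u₁' + c₁ < u₂'`: the backward past through `X v₁`'s level reaches the top of the forward
evolution, a coarse intermediate-value argument (`PathUpgradeRCompat.exists_level_crossing`)
produces a point of it at forward level `u₂`, whose backward level `s₃ ≤ u₁'` must be
`w''`-close to `u₂'` by `injB` — contradiction. [folklore] -/
theorem stub_compat : ∀ (X : Literature.Probability.RandomPlanarGeometry.Curve ℂ), Function.Injective X → ∀ (Xf Xb r r' : NNReal → ℂ) (T T' : NNReal) (utop : unitInterval) (b : ℂ) (ε ε' μ ν μ'' μ₀ w w'' c₀ c₁ Ttop rb rb' : ℝ), Continuous Xf → Continuous Xb → Continuous r → Continuous r' → 0 < ε → 0 < ε' → 0 < w → 0 < w'' → w'' ≤ c₁ → 0 < c₀ → 3 * w ≤ c₀ → 3 * ε + 3 * ε' < μ → 3 * ε + 3 * ε' + ν < μ'' → 0 < rb → rb < rb' → Ttop + 3 * w ≤ T + 1 → (∀ t : NNReal, (t : ℝ) ≤ T + 1 → ∃ u : unitInterval, X u = Xf t ∧ X '' Set.Icc 0 u = Xf '' Set.Icc 0 t) → (∀ t : NNReal, (t : ℝ) ≤ T' + 1 → ∃ u : unitInterval, X u =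 Xb t ∧ X '' Set.Icc u 1 = Xb '' Set.Icc 0 t) → X utop = Xf (T + 1) → X '' Set.Icc 0 utop = Xf '' Set.Icc 0 (T + 1) → (∀ t : NNReal, (t : ℝ) ≤ T + 1 → Metric.hausdorffDist (Xf '' Set.Icc 0 t) (r '' Set.Icc 0 t) ≤ ε) → (∀ t : NNReal, (t : ℝ) ≤ T' + 1 → Metric.hausdorffDist (Xb '' Set.Icc 0 t) (r' '' Set.Icc 0 t) ≤ ε') → (∀ s t : NNReal, (s : ℝ) ≤ T + 1 → (t : ℝ) ≤ T + 1 → w ≤ |(s : ℝ) - t| → μ ≤ dist (r s) (r t)) → (∀ s t : NNReal, (s : ℝ) ≤ T + 1 → (t : ℝ) ≤ T + 1 → |(s : ℝ) - t| ≤ 2 * w → dist (r s) (r t) ≤ ν) → (∀ s t : NNReal, (s : ℝ) ≤ T + 1 → (t : ℝ) ≤ T + 1 → c₀ / 4 ≤ |(s : ℝ) - t| → μ₀ ≤ dist (r s) (r t)) → (∀ s t : NNReal, (s : ℝ) ≤ T' + 1 → (t : ℝ) ≤ T' + 1 → w'' ≤ |(s : ℝ) - t| → μ'' ≤ dist (r'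 s) (r' t)) → (∀ s t : NNReal, (s : ℝ) ≤ T' + 1 → (t : ℝ) ≤ T' + 1 → |(s : ℝ) - t| ≤ c₁ → dist (r' s) (r' t) < μ₀ - 4 * ε - 4 * ε') → (∀ u : NNReal, (u : ℝ) ≤ Ttop + 2 * w → rb' + 2 * ε + 3 * ε' < dist (r u) b) → dist (r (T + 1)) b + ε ≤ rb → (∀ v : unitInterval, utop < v → dist (X v) b < rb) → (∀ v v' : unitInterval, v ≤ v' → dist (X v) b ≤ rb → dist (X v') b < rb') → ∀ v₁ v₂ : unitInterval, ∀ u₁ u₂ : NNReal, (u₂ : ℝ) ≤ Ttop → dist (X v₁) (r u₁) ≤ 2 * ε → dist (X v₂) (r u₂) ≤ 2 * ε → (u₁ : ℝ) + 2 * c₀ ≤ u₂ → ∀ u₁' u₂' : NNReal, (u₁' : ℝ) ≤ T' + 1 → (u₂' : ℝ) ≤ T' + 1 → dist (X v₁) (r' u₁') ≤ 2 * ε' → dist (X v₂) (r' u₂') ≤ 2 * ε' → (u₂' : ℝ) + c₁ ≤ u₁' := by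
  intro X _ Xf Xb r r' T T' utop b ε ε' μ ν μ'' μ₀ w w'' c₀ c₁ Ttop rb rb' _ _ hr hr' hε hε' hw
    _ hw''c₁ hc₀ hwc₀ hμ hμ'' _ _ hTtop _ segB _ htop' shF shB injF contF inj0F injB contB
    Z2 Ztop _ Z5 v₁ v₂ u₁ u₂ hu₂T hv₁ hv₂ hu₁₂ u₁' u₂' hu₁'T hu₂'T hv₁' hv₂'
  -- time bounds, in `ℝ` and in `ℝ≥0`
  have hTm : ∀ {u : ℝ≥0}, u ≤ T + 1 ↔ (u : ℝ) ≤ T + 1 := fun {u} => by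
    rw [← NNReal.coe_le_coe, NNReal.coe_add, NNReal.coe_one]
  have hu₂R : (u₂ : ℝ) ≤ T + 1 := by linarith
  have hu₁R : (u₁ : ℝ) ≤ T + 1 := by linarith
  have hu₂N : u₂ ≤ T + 1 := hTm.2 hu₂R
  have injF' : ∀ s t : ℝ≥0, s ≤ T + 1 → t ≤ T + 1 → w ≤ |(s : ℝ) - t| → μ ≤ dist (r s) (r t) :=
    fun s t hs ht => injF s t (hTm.1 hs) (hTm.1 ht)
  refine le_of_not_gt fun hcon => ?_
  rcases le_or_gt ((u₂' : ℝ) - c₁) u₁' with hA | hB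
  · -- Case A: `|u₁' - u₂'| ≤ c₁`: five-term triangle inequality against `μ₀`
    have h1 : dist (r' u₁') (r' u₂') < μ₀ - 4 * ε - 4 * ε' :=
      contB u₁' u₂' hu₁'T hu₂'T (abs_sub_le_iff.2 ⟨by linarith, by linarith⟩)
    have h2 : μ₀ ≤ dist (r u₁) (r u₂) :=
      inj0F u₁ u₂ hu₁R hu₂R (by rw [abs_sub_comm, abs_of_nonneg (by linarith)]; linarith)
    linarith [dist_triangle4 (r u₁) (X v₁) (r' u₁') (r' u₂'),
      dist_triangle4 (r u₁) (r' u₂') (X v₂) (r u₂), dist_comm (r u₁) (X v₁),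
      dist_comm (r' u₂') (X v₂)]
  · -- Case B: `u₁' + c₁ < u₂'`
    -- (1) the backward past `X '' Icc vb 1 = Xb '' Icc 0 u₁'` has a point `X vz` near `r' u₁'`,
    -- hence near `r u₁`, hence outside the ball `B(b, rb')`
    obtain ⟨vb, -, hvb⟩ := segB u₁' hu₁'T
    have hshB := shB u₁' hu₁'T
    rw [← hvb] at hshB
    have hcP : IsCompact (X '' Set.Icc vb 1) := isClosed_Icc.isCompact.image X.continuous
    have hcR' : IsCompact (r' '' Set.Icc 0 u₁') := isCompact_Icc.image hr'
    obtain ⟨_, ⟨vz, hvz, rfl⟩, hz⟩ := exists_dist_le_of_hausdorffDist_le' hcP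
      ((nonempty_Icc.2 unitInterval.le_one').image X) hcR'.isBounded
      (mem_image_of_mem r' (right_mem_Icc.2 zero_le)) hshB
    have hz₁ : dist (X vz) (r u₁) ≤ 2 * ε + 3 * ε' := by
      linarith [dist_triangle4 (X vz) (r' u₁') (X v₁) (r u₁), dist_comm (X v₁) (r' u₁')]
    have hzb : rb' < dist (X vz) b := by
      have hZ := Z2 u₁ (by linarith)
      linarith [dist_triangle (r u₁) (X vz) b, dist_comm (r u₁) (X vz)]
    -- (2) the top segment `X '' Icc 0 utop` has a point `X vs` near `r (T+1)`, inside `B(b, rb)`;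
    -- no escape forces `vz ≤ vs`
    have hshF := shF (T + 1) (by push_cast; exact le_rfl)
    rw [← htop'] at hshF
    have hcTop : IsCompact (X '' Set.Icc 0 utop) := isClosed_Icc.isCompact.image X.continuous
    have hcR : IsCompact (r '' Set.Icc 0 (T + 1)) := isCompact_Icc.image hr
    obtain ⟨_, ⟨vs, hvs, rfl⟩, hs⟩ := exists_dist_le_of_hausdorffDist_le' hcTop
      ((nonempty_Icc.2 unitInterval.nonneg').image X) hcR.isBounded
      (mem_image_of_mem r (right_mem_Icc.2 zero_le)) hshF
    have hsb : dist (X vs) b ≤ rb := by linarith [dist_triangle (X vs) (r (T + 1)) b]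
    have hzs : vz ≤ vs := by
      by_contra h
      have := Z5 vs vz (not_le.1 h).le hsb
      linarith
    -- (3) coarse intermediate value: a point `X vm`, `vm ∈ [vz, vs]`, at forward level `u₂`
    have hcover : ∀ v ∈ Set.Icc vz vs, ∃ u : ℝ≥0, u ≤ T + 1 ∧ dist (X v) (r u) ≤ ε := by
      intro v hv
      obtain ⟨_, ⟨u, hu, rfl⟩, hd⟩ := exists_dist_le_of_hausdorffDist_le hcTop.isBounded hcR
        ((nonempty_Icc.2 zero_le).image r)
        (mem_image_of_mem X ⟨unitInterval.nonneg', hv.2.trans hvs.2⟩) hshF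
      exact ⟨u, hu.2, hd⟩
    have hz' : ∃ u : ℝ≥0, u ≤ u₂ ∧ dist (X vz) (r u) ≤ ε := by
      obtain ⟨uz, huz, hd⟩ := hcover vz (left_mem_Icc.2 hzs)
      refine ⟨uz, ?_, hd⟩
      have h1 : |(uz : ℝ) - u₁| < w := abs_sub_lt_of_dist_lt injF' huz (hTm.2 hu₁R)
        (by linarith [dist_triangle_left (r uz) (r u₁) (X vz)])
      have h2 : (uz : ℝ) ≤ u₂ := by
        rw [abs_sub_lt_iff] at h1
        linarith [h1.1]
      exact NNReal.coe_le_coe.1 h2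
    obtain ⟨vm, hvm, um, hum₂, humw, humT, hdm⟩ := exists_level_crossing X.continuous hr hu₂N
      (by linarith) injF' hzs hcover hz' ⟨T + 1, hu₂N, le_rfl, hs⟩
    -- (4) `X vm` lies in the backward past, hence is near some `r' s₃`, `s₃ ≤ u₁'`
    obtain ⟨_, ⟨s₃, hs₃, rfl⟩, hd₃⟩ := exists_dist_le_of_hausdorffDist_le hcP.isBounded hcR'
      ((nonempty_Icc.2 zero_le).image r')
      (mem_image_of_mem X ⟨hvz.1.trans hvm.1, unitInterval.le_one'⟩) hshB
    -- (5) `r' s₃` is `μ''`-close to `r' u₂'`, so `|s₃ - u₂'| < w'' ≤ c₁`: contradiction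
    have hum₂' : (u₂ : ℝ) ≤ um := NNReal.coe_le_coe.2 hum₂
    have hν : dist (r um) (r u₂) ≤ ν :=
      contF um u₂ (hTm.1 humT) hu₂R (abs_sub_le_iff.2 ⟨by linarith, by linarith⟩)
    have hd : dist (r' s₃) (r' u₂') < μ'' := by
      linarith [dist_triangle4 (r' s₃) (X vm) (r um) (r u₂),
        dist_triangle4 (r' s₃) (r u₂) (X v₂) (r' u₂'), dist_comm (r' s₃) (X vm),
        dist_comm (r u₂) (X v₂)]
    have hs₃u : (s₃ : ℝ) ≤ u₁' := NNReal.coe_le_coe.2 hs₃.2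
    have h3 : |(s₃ : ℝ) - u₂'| < w'' :=
      not_le.1 fun h => absurd hd (not_lt.2 (injB s₃ u₂' (hs₃u.trans hu₁'T) hu₂'T h))
    rw [abs_sub_lt_iff] at h3
    linarith [h3.1, h3.2]

end Summit.CriticalPhenomena.SAWScalingLimit.Theorems
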